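import Summits.QuantumFields.YangMills.Theorems.SwapVirialDeficitTwistedLogDetUniformLemmas
import Literature.Analysis.Matrix.TwistedCycleLaplacian
import HarnessLib

/-!
# ONE-LOOP UNIFORMITY, analytic half: the flux dependence of a twisted-torus log-determinant is `O(1)` UNIFORMLY IN THE VOLUME
# once the transverse zero mode is set aside (free-hands support of ⟨stmt-QuantumFields-24197⟩ `SwapVirialDeficit.SwapGluedStiffness`;
# stub S4∕S5 «bottom tails ∕ tip share with poly(L) constants» of fcl-p3 g47's sector skeleton = «one-loop uniformity», fcl-p3 g46 memo3 §3, w3 g65 numerics memo §5)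

THE OBJECT.  A discrete torus with `m` transverse directions of `n` sites each and one summed («time») direction of `t` sites; constant link phases.
A transverse mode `k : Fin m → Fin n` with reduced transverse angles `x_ν(k) = x₀ν + π k_ν/n` (`0 ≤ x₀ν < π/n`) has transverse eigenvalue
`λ(k) = Σ_ν 4 sin² x_ν(k)` and frequency `ω(k) = 2 arsinh(√λ(k)/2)` (`4 sinh²(ω/2) = λ`).  Summing the time direction EXACTLY (lit ✓
`TwistedCycleLaplacian.prod_four_sinh_sq_add_four_sin_sq_add`): `∏_{q<t} (λ(k) + 4 sin²(φ/2 + πq/t)) = 4 sinh²(tω(k)/2) + 4 sin²(tφ/2)`, so the whole flux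
dependence of mode `k` on the time flux `Φ = tφ` is the term `log(4 sinh²(tω(k)/2) + 4 sin²(Φ/2))`, and
`|Δ_Φ log(4 sinh²(tω/2) + 4 sin² ·)| ≤ 1/sinh²(tω(k)/2) = 4e^{−tω}/(1 − e^{−tω})²`.
Off the transverse zero mode `k⋆` (`k⋆_ν = 0` or `n−1` according to `x₀ν ≤ π/(2n)` or not) every mode has `λ ≥ 4/n²`, hence `tω ≥ 4/3` for `t ≥ n`,
and `Σ_k e^{−tω(k)} ≤ (2/(1 − e^{−8/(3m)}))^m` (arsinh-monotonicity `ω(Σλ_ν) ≥ ω(λ_ν)`, `arsinh y ≥ 2y/3` on `[0,1]`, Jordan `sin x ≥ 2x/π`, two geometric sums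
per direction).  RESULT:
* §1–§2 = the prequel ✓`…TwistedLogDetUniformLemmas` (`inv_four_sinh_sq_half_le`, `abs_log_add_sub_log_add_le`, `two_thirds_mul_le_arsinh`, `arsinh_sin_ge`,
  `sum_exp_neg_mul_min_le`);
* §3 the transverse torus (everything written out, no `def`): `transAngle_mem`, `transLam_nonneg`, `four_sinh_sq_transFreq_half` (`4sinh²(ω/2) = λ`),
  `transFreq_ge_coord` (`ω(k) ≥ 2arsinh|sin x_ν(k)|`), `exp_neg_mul_transFreq_le`, ★ `sum_exp_neg_transFreq_le` (`Σ_k e^{−tω(k)} ≤ (2/(1 − e^{−8t/(3mn)}))^m`);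
* §4 ★ `transFreq_ge_off_zeroMode` (`k ≠ k⋆ ⟹ 4/3 ≤ tω(k)` for `n ≤ t`), ★★★ `abs_sum_log_flux_sub_le` — THE UNIFORMITY THEOREM: for `1 ≤ m`, `1 ≤ n ≤ t`,
  reduced phases `x₀`, and any two fluxes `Φ, Φ′` of the summed direction,
  `|Σ_{k ≠ k⋆} [log(4sinh²(tω(k)/2) + 4sin²(Φ/2)) − log(4sinh²(tω(k)/2) + 4sin²(Φ′/2))]| ≤ 4/(1 − e^{−4/3})² · (2/(1 − e^{−8/(3m)}))^m` — a constant
  depending on the transverse DIMENSION only, not on `n`, `t`, the phases or the fluxes;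
* §5 ★★ `sum_log_time_eq` — the exact time sum per gapped mode: `Σ_{q<t} log(λ(k) + 4sin²(φ/2 + πq/t)) = log(4sinh²(tω(k)/2) + 4sin²(tφ/2))` (`0 < λ(k)`).
What is NOT here: the reduction of arbitrary phases to `x₀ν ∈ [0, π/n)` (a re-indexing of `Fin n`), the zero-mode term itself (kept explicit by the consumer:
`log(4sinh²(tω(k⋆)/2) + 4sin²(Φ/2))`, the `log|Θ|²` apex singularity), and the MODEL half of S4 (the fibre Hessian at a flat ring point IS a sum of such
twisted Laplacians — the neutral∕charged split under `Ad` of the torus; unowned).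

HONEST LABEL: classical finite-dimensional real analysis; nothing about the ring's Gibbs state; S4∕S5, ⟨24197⟩ (window-uniform) ∕ ⟨24194⟩ ∕ ⟨24497⟩ OPEN;
own crux ⟨22884⟩ OPEN (blocked-on ⟨19935⟩); no crux, rung of record or summit is proved; the Yang–Mills mass gap is NOT proved; no summit is proved by a line.
THEOREMS ONLY (0 `def`, 0 `sorry`), standard axioms.  Width seat ym-line-sfw-p2-w3 g66 (cell ym-idea-1, free hands), `--supports stmt-QuantumFields-24197`.

## References
* M. Lüscher, *Some analytic results concerning the mass spectrum of Yang–Mills gauge theories on a torus*, Nucl. Phys. B219 (1983) 233–261, App. (one-loop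
  sums over twisted momenta). [Luscher1983]
* E. H. Lieb, M. Loss, *Fluxes, Laplacians, and Kasteleyn's theorem*, Duke Math. J. 71 (1993), §4 (4.9) (the flux enters the ring determinant only through
  `det T`). [LiebLoss1993]
* M. García Pérez, A. González-Arroyo, M. Okawa, JHEP 10 (2017) 150, §2.3–§2.5 (twisted momenta `q̂² = Σ_μ 4 sin²(q_μ/2)`). [GarciaperezGonzalezarroyoOkawa2017]
-/

set_option autoImplicit false

noncomputable section

open Real Finset
open scoped BigOperators

namespace Summit.QuantumFields.YangMills.Theorems.OneLoopUniform

/-! ## §3 The transverse torus: modes `k : Fin m → Fin n`, reduced angles `x_ν(k) = x₀ν + πk_ν/n`, eigenvalue `λ(k) = Σ_ν 4sin²x_ν(k)`,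
frequency `ω(k) = 2arsinh(√λ(k)/2)` (all written out; no definitions) -/

section Transverse

variable {m n : ℕ} (x₀ : Fin m → ℝ)

/-- The reduced angles lie in `[0, π]` when `0 ≤ x₀ν ≤ π/n`. [folklore] -/
theorem transAngle_mem (hn : 0 < n) (hx : ∀ ν, 0 ≤ x₀ ν ∧ x₀ ν ≤ Real.pi / n) (k : Fin m → Fin n) (ν : Fin m) :
    0 ≤ x₀ ν + Real.pi * (k ν : ℕ) / n ∧ x₀ ν + Real.pi * (k ν : ℕ) / n ≤ Real.pi := by
  have hπ := Real.pi_pos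
  have hnr : (0 : ℝ) < n := by exact_mod_cast hn
  have hk : ((k ν : ℕ) : ℝ) ≤ (n : ℝ) - 1 := by
    have := (k ν).isLt
    have h1 : (k ν : ℕ) ≤ n - 1 := by omega
    have h2 : ((n - 1 : ℕ) : ℝ) = (n : ℝ) - 1 := by rw [Nat.cast_sub (by omega)]; simp
    rw [← h2]; exact_mod_cast h1
  refine ⟨by have := (hx ν).1; positivity, ?_⟩
  have h3 : Real.pi * (k ν : ℕ) / n ≤ Real.pi * ((n : ℝ) - 1) / n := by gcongr
  have h4 : Real.pi * ((n : ℝ) - 1) / n = Real.pi - Real.pi / n := by field_simp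
  linarith [(hx ν).2]

/-- The transverse eigenvalue is non-negative. [folklore] -/
theorem transLam_nonneg (k : Fin m → Fin n) : 0 ≤ ∑ ν, 4 * Real.sin (x₀ ν + Real.pi * (k ν : ℕ) / n) ^ 2 :=
  Finset.sum_nonneg fun ν _ => by positivity

/-- `4 sinh²(ω(k)/2) = λ(k)`: the frequency inverts the dispersion relation. [cite: GarciaperezGonzalezarroyoOkawa2017, §2.5] -/
theorem four_sinh_sq_transFreq_half (k : Fin m → Fin n) :
    4 * Real.sinh (2 * Real.arsinh (Real.sqrt (∑ ν, 4 * Real.sin (x₀ ν + Real.pi * (k ν : ℕ) / n) ^ 2) / 2) / 2) ^ 2 =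
      ∑ ν, 4 * Real.sin (x₀ ν + Real.pi * (k ν : ℕ) / n) ^ 2 := by
  rw [show 2 * Real.arsinh (Real.sqrt (∑ ν, 4 * Real.sin (x₀ ν + Real.pi * (k ν : ℕ) / n) ^ 2) / 2) / 2 =
      Real.arsinh (Real.sqrt (∑ ν, 4 * Real.sin (x₀ ν + Real.pi * (k ν : ℕ) / n) ^ 2) / 2) by ring, Real.sinh_arsinh, div_pow,
    Real.sq_sqrt (transLam_nonneg x₀ k)]
  ring

/-- ★ **Each transverse direction bounds the frequency from below**: `2 arsinh|sin x_ν(k)| ≤ ω(k)`. [cite: GarciaperezGonzalezarroyoOkawa2017, §2.5] -/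
theorem transFreq_ge_coord (k : Fin m → Fin n) (ν : Fin m) :
    2 * Real.arsinh |Real.sin (x₀ ν + Real.pi * (k ν : ℕ) / n)| ≤
      2 * Real.arsinh (Real.sqrt (∑ μ, 4 * Real.sin (x₀ μ + Real.pi * (k μ : ℕ) / n) ^ 2) / 2) := by
  have h1 : 4 * Real.sin (x₀ ν + Real.pi * (k ν : ℕ) / n) ^ 2 ≤ ∑ μ, 4 * Real.sin (x₀ μ + Real.pi * (k μ : ℕ) / n) ^ 2 :=
    Finset.single_le_sum (f := fun μ => 4 * Real.sin (x₀ μ + Real.pi * (k μ : ℕ) / n) ^ 2) (fun μ _ => by positivity) (Finset.mem_univ ν)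
  have h2 : |Real.sin (x₀ ν + Real.pi * (k ν : ℕ) / n)| = Real.sqrt (4 * Real.sin (x₀ ν + Real.pi * (k ν : ℕ) / n) ^ 2) / 2 := by
    rw [show (4 : ℝ) * Real.sin (x₀ ν + Real.pi * (k ν : ℕ) / n) ^ 2 = (2 * |Real.sin (x₀ ν + Real.pi * (k ν : ℕ) / n)|) ^ 2 by
      rw [mul_pow, sq_abs]; ring, Real.sqrt_sq (by positivity)]
    ring
  rw [h2]
  have h3 := Real.sqrt_le_sqrt h1
  linarith [Real.arsinh_le_arsinh.2 (show Real.sqrt (4 * Real.sin (x₀ ν + Real.pi * (k ν : ℕ) / n) ^ 2) / 2 ≤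
    Real.sqrt (∑ μ, 4 * Real.sin (x₀ μ + Real.pi * (k μ : ℕ) / n) ^ 2) / 2 by linarith)]

/-- ★ **`e^{−tω(k)}` is dominated by the product over the directions of `e^{−(8t/(3πm))·min(x_ν, π − x_ν)}`** (`mω(k) ≥ Σ_ν 2arsinh(sin x_ν) ≥ Σ_ν (8/(3π))min(x_ν,π−x_ν)`).
[folklore] -/
theorem exp_neg_mul_transFreq_le (hm : 0 < m) (hn : 0 < n) (hx : ∀ ν, 0 ≤ x₀ ν ∧ x₀ ν ≤ Real.pi / n) {t : ℝ} (ht : 0 ≤ t) (k : Fin m → Fin n) :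
    Real.exp (-(t * (2 * Real.arsinh (Real.sqrt (∑ μ, 4 * Real.sin (x₀ μ + Real.pi * (k μ : ℕ) / n) ^ 2) / 2)))) ≤
      ∏ ν, Real.exp (-(8 * t / (3 * Real.pi * m) * min (x₀ ν + Real.pi * (k ν : ℕ) / n) (Real.pi - (x₀ ν + Real.pi * (k ν : ℕ) / n)))) := by
  have hmr : (0 : ℝ) < m := by exact_mod_cast hm
  have hπ := Real.pi_pos
  -- per-direction lower bound
  have hν : ∀ ν, 4 / (3 * Real.pi) * min (x₀ ν + Real.pi * (k ν : ℕ) / n) (Real.pi - (x₀ ν + Real.pi * (k ν : ℕ) / n)) ≤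
      Real.arsinh (Real.sqrt (∑ μ, 4 * Real.sin (x₀ μ + Real.pi * (k μ : ℕ) / n) ^ 2) / 2) := by
    intro ν
    obtain ⟨h0, hπ'⟩ := transAngle_mem x₀ hn hx k ν
    have h1 := arsinh_sin_ge h0 hπ'
    have h2 := transFreq_ge_coord x₀ k ν
    rw [abs_of_nonneg (Real.sin_nonneg_of_nonneg_of_le_pi h0 hπ')] at h2
    linarith
  -- sum over directions: `m · arsinh(…) ≥ Σ_ν (4/(3π)) min`
  have hsum : ∑ ν, 4 / (3 * Real.pi) * min (x₀ ν + Real.pi * (k ν : ℕ) / n) (Real.pi - (x₀ ν + Real.pi * (k ν : ℕ) / n)) ≤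
      (m : ℝ) * Real.arsinh (Real.sqrt (∑ μ, 4 * Real.sin (x₀ μ + Real.pi * (k μ : ℕ) / n) ^ 2) / 2) := by
    have h := Finset.sum_le_sum fun ν (_ : ν ∈ (Finset.univ : Finset (Fin m))) => hν ν
    rwa [Finset.sum_const, Finset.card_univ, Fintype.card_fin, nsmul_eq_mul] at h
  rw [← Real.exp_sum, Real.exp_le_exp]
  have ht2 : 0 ≤ 2 * t / m := by positivity
  set W : ℝ := Real.arsinh (Real.sqrt (∑ μ, 4 * Real.sin (x₀ μ + Real.pi * (k μ : ℕ) / n) ^ 2) / 2) with hW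
  calc -(t * (2 * W))
      = -(2 * t / m) * ((m : ℝ) * W) := by
        field_simp
    _ ≤ -(2 * t / m) * ∑ ν, 4 / (3 * Real.pi) * min (x₀ ν + Real.pi * (k ν : ℕ) / n) (Real.pi - (x₀ ν + Real.pi * (k ν : ℕ) / n)) :=
        mul_le_mul_of_nonpos_left hsum (by linarith)
    _ = ∑ ν, -(8 * t / (3 * Real.pi * m) * min (x₀ ν + Real.pi * (k ν : ℕ) / n) (Real.pi - (x₀ ν + Real.pi * (k ν : ℕ) / n))) := by
        rw [Finset.mul_sum]
        refine Finset.sum_congr rfl fun ν _ => ?_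
        generalize min (x₀ ν + Real.pi * (k ν : ℕ) / n) (Real.pi - (x₀ ν + Real.pi * (k ν : ℕ) / n)) = M
        field_simp
        ring

/-- ★★ **The transverse exponential sum is bounded by a constant depending only on `m` and `t/n`**:
`Σ_{k : Fin m → Fin n} e^{−tω(k)} ≤ (2/(1 − e^{−8t/(3mn)}))^m` (`t > 0`). [folklore] -/
theorem sum_exp_neg_transFreq_le (hm : 0 < m) (hn : 0 < n) (hx : ∀ ν, 0 ≤ x₀ ν ∧ x₀ ν ≤ Real.pi / n) {t : ℝ} (ht : 0 < t) :
    ∑ k : Fin m → Fin n, Real.exp (-(t * (2 * Real.arsinh (Real.sqrt (∑ μ, 4 * Real.sin (x₀ μ + Real.pi * (k μ : ℕ) / n) ^ 2) / 2)))) ≤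
      (2 / (1 - Real.exp (-(8 * t / (3 * m * n))))) ^ m := by
  have hmr : (0 : ℝ) < m := by exact_mod_cast hm
  have hnr : (0 : ℝ) < n := by exact_mod_cast hn
  have hπ := Real.pi_pos
  set s : ℝ := 8 * t / (3 * Real.pi * m) with hs
  have hs0 : 0 < s := by positivity
  -- the product bound, then exchange sum and product
  have h1 : ∑ k : Fin m → Fin n, Real.exp (-(t * (2 * Real.arsinh (Real.sqrt (∑ μ, 4 * Real.sin (x₀ μ + Real.pi * (k μ : ℕ) / n) ^ 2) / 2)))) ≤
      ∑ k : Fin m → Fin n, ∏ ν, Real.exp (-(s * min (x₀ ν + Real.pi * (k ν : ℕ) / n) (Real.pi - (x₀ ν + Real.pi * (k ν : ℕ) / n)))) :=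
    Finset.sum_le_sum fun k _ => exp_neg_mul_transFreq_le x₀ hm hn hx ht.le k
  have h2 : ∑ k : Fin m → Fin n, ∏ ν, Real.exp (-(s * min (x₀ ν + Real.pi * (k ν : ℕ) / n) (Real.pi - (x₀ ν + Real.pi * (k ν : ℕ) / n)))) =
      ∏ ν : Fin m, ∑ j : Fin n, Real.exp (-(s * min (x₀ ν + Real.pi * (j : ℕ) / n) (Real.pi - (x₀ ν + Real.pi * (j : ℕ) / n)))) := by
    simp only [Finset.prod_univ_sum, Fintype.piFinset_univ]
  have h3 : ∀ ν : Fin m, ∑ j : Fin n, Real.exp (-(s * min (x₀ ν + Real.pi * (j : ℕ) / n) (Real.pi - (x₀ ν + Real.pi * (j : ℕ) / n)))) ≤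
      2 / (1 - Real.exp (-(s * Real.pi / n))) := by
    intro ν
    rw [Fin.sum_univ_eq_sum_range (fun j => Real.exp (-(s * min (x₀ ν + Real.pi * (j : ℕ) / n) (Real.pi - (x₀ ν + Real.pi * (j : ℕ) / n))))) n]
    exact sum_exp_neg_mul_min_le hn hs0 (hx ν).1 (hx ν).2
  have h5 : ∏ ν : Fin m, ∑ j : Fin n, Real.exp (-(s * min (x₀ ν + Real.pi * (j : ℕ) / n) (Real.pi - (x₀ ν + Real.pi * (j : ℕ) / n)))) ≤
      ∏ _ν : Fin m, 2 / (1 - Real.exp (-(s * Real.pi / n))) :=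
    Finset.prod_le_prod (fun ν _ => Finset.sum_nonneg fun j _ => (Real.exp_pos _).le) fun ν _ => h3 ν
  rw [Finset.prod_const, Finset.card_univ, Fintype.card_fin] at h5
  have h6 : s * Real.pi / n = 8 * t / (3 * m * n) := by rw [hs]; field_simp
  rw [h6] at h5
  exact h1.trans (h2.le.trans h5)

end Transverse

/-! ## §4 Off the transverse zero mode: the gap `tω(k) ≥ 4/3`, and THE UNIFORMITY THEOREM -/

section Uniform

variable {m n : ℕ} (x₀ : Fin m → ℝ)

/-- ★ **Off the transverse zero mode every mode is gapped at scale `1/n`**: with the zero mode `k⋆_ν = 0` if `x₀ν ≤ π/(2n)` and `k⋆_ν = n − 1` otherwise,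
every `k ≠ k⋆` has some direction with `min(x_ν, π − x_ν) ≥ π/(2n)`, hence `sin x_ν ≥ 1/n`, `ω(k) ≥ 4/(3n)` and `tω(k) ≥ 4/3` for `t ≥ n`. [folklore] -/
theorem transFreq_ge_off_zeroMode (hn : 0 < n) (hx : ∀ ν, 0 ≤ x₀ ν ∧ x₀ ν ≤ Real.pi / n) (k : Fin m → Fin n)
    (hk : k ≠ fun ν => if x₀ ν ≤ Real.pi / (2 * n) then (⟨0, hn⟩ : Fin n) else ⟨n - 1, Nat.sub_lt hn one_pos⟩) {t : ℝ} (ht : (n : ℝ) ≤ t) :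
    4 / 3 ≤ t * (2 * Real.arsinh (Real.sqrt (∑ μ, 4 * Real.sin (x₀ μ + Real.pi * (k μ : ℕ) / n) ^ 2) / 2)) := by
  have hnr : (0 : ℝ) < n := by exact_mod_cast hn
  have hπ := Real.pi_pos
  obtain ⟨ν, hν⟩ := Function.ne_iff.1 hk
  -- the distance of `x_ν(k)` to `{0, π}` is at least `π/(2n)`
  have hkn : (k ν : ℕ) ≤ n - 1 := by have := (k ν).isLt; omega
  have hcast1 : ((n - 1 : ℕ) : ℝ) = (n : ℝ) - 1 := by rw [Nat.cast_sub (by omega)]; simp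
  have hd : Real.pi / (2 * n) ≤ min (x₀ ν + Real.pi * (k ν : ℕ) / n) (Real.pi - (x₀ ν + Real.pi * (k ν : ℕ) / n)) := by
    by_cases hc : x₀ ν ≤ Real.pi / (2 * n)
    · simp only [hc, if_true] at hν
      have hk1 : 1 ≤ (k ν : ℕ) := by
        rcases Nat.eq_zero_or_pos (k ν : ℕ) with h0 | h0
        · exact absurd (Fin.ext h0) hν
        · exact h0
      have hk1r : (1 : ℝ) ≤ ((k ν : ℕ) : ℝ) := by exact_mod_cast hk1
      have hknr : ((k ν : ℕ) : ℝ) ≤ (n : ℝ) - 1 := by rw [← hcast1]; exact_mod_cast hkn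
      refine le_min ?_ ?_
      · have h1 : Real.pi / (2 * n) ≤ Real.pi * 1 / n := by
          rw [div_le_div_iff₀ (by positivity) hnr]; nlinarith
        have h2 : Real.pi * 1 / n ≤ Real.pi * (k ν : ℕ) / n := by gcongr
        linarith [(hx ν).1]
      · have h2 : Real.pi * (k ν : ℕ) / n ≤ Real.pi * ((n : ℝ) - 1) / n := by gcongr
        have h3 : Real.pi * ((n : ℝ) - 1) / n = Real.pi - 2 * (Real.pi / (2 * n)) := by field_simp
        linarith [(hx ν).2, hc]
    · have hc' : Real.pi / (2 * n) < x₀ ν := lt_of_not_ge hc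
      simp only [hc, if_false] at hν
      have hk2 : (k ν : ℕ) ≤ n - 2 := by
        have hne : (k ν : ℕ) ≠ n - 1 := fun h => hν (Fin.ext h)
        omega
      have hn2 : 2 ≤ n := by
        by_contra hlt
        have : n = 1 := by omega
        subst this
        have h0 : (k ν : ℕ) = 0 := by omega
        exact hν (Fin.ext h0)
      have hcast2 : ((n - 2 : ℕ) : ℝ) = (n : ℝ) - 2 := by rw [Nat.cast_sub hn2]; simp
      have hknr : ((k ν : ℕ) : ℝ) ≤ (n : ℝ) - 2 := by rw [← hcast2]; exact_mod_cast hk2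
      refine le_min ?_ ?_
      · have : 0 ≤ Real.pi * (k ν : ℕ) / n := by positivity
        linarith
      · have h2 : Real.pi * (k ν : ℕ) / n ≤ Real.pi * ((n : ℝ) - 2) / n := by gcongr
        have h3 : Real.pi * ((n : ℝ) - 2) / n = Real.pi - 4 * (Real.pi / (2 * n)) := by field_simp; ring
        have h4 : Real.pi / n = 2 * (Real.pi / (2 * n)) := by field_simp
        linarith [(hx ν).2]
  -- hence `sin x_ν ≥ 1/n`, `arsinh (sin x_ν) ≥ 2/(3n)`
  obtain ⟨h0, hπ'⟩ := transAngle_mem x₀ hn hx k ν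
  have hsin : 1 / (n : ℝ) ≤ Real.sin (x₀ ν + Real.pi * (k ν : ℕ) / n) := by
    have hj := two_div_pi_mul_min_le_sin h0 hπ'
    have h1 : 1 / (n : ℝ) = 2 / Real.pi * (Real.pi / (2 * n)) := by field_simp
    rw [h1]
    exact le_trans (mul_le_mul_of_nonneg_left hd (by positivity)) hj
  have hs1 : Real.sin (x₀ ν + Real.pi * (k ν : ℕ) / n) ≤ 1 := Real.sin_le_one _
  have hsn : 0 ≤ Real.sin (x₀ ν + Real.pi * (k ν : ℕ) / n) := Real.sin_nonneg_of_nonneg_of_le_pi h0 hπ'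
  have har := two_thirds_mul_le_arsinh hsn hs1
  have hco := transFreq_ge_coord x₀ k ν
  rw [abs_of_nonneg hsn] at hco
  -- `ω(k) ≥ 4/(3n)` and `t ≥ n`
  have hω : 4 / (3 * (n : ℝ)) ≤ 2 * Real.arsinh (Real.sqrt (∑ μ, 4 * Real.sin (x₀ μ + Real.pi * (k μ : ℕ) / n) ^ 2) / 2) := by
    have : 4 / (3 * (n : ℝ)) = 2 * (2 / 3 * (1 / (n : ℝ))) := by ring
    rw [this]; nlinarith
  have hωnn : 0 ≤ 2 * Real.arsinh (Real.sqrt (∑ μ, 4 * Real.sin (x₀ μ + Real.pi * (k μ : ℕ) / n) ^ 2) / 2) :=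
    le_trans (by positivity) hω
  calc (4 : ℝ) / 3 = (n : ℝ) * (4 / (3 * (n : ℝ))) := by field_simp
    _ ≤ t * (2 * Real.arsinh (Real.sqrt (∑ μ, 4 * Real.sin (x₀ μ + Real.pi * (k μ : ℕ) / n) ^ 2) / 2)) :=
        mul_le_mul ht hω (by positivity) (hnr.le.trans ht)

/-- ★★★ **THE UNIFORMITY THEOREM.**  For `m ≥ 1` transverse directions of `n ≥ 1` sites with reduced phases `x₀ν ∈ [0, π/n]`, a summed direction of
length `t ≥ n`, and ANY two fluxes `Φ, Φ′` of the summed direction: the flux dependence of the log-determinant summed over all transverse modes EXCEPT the zero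
mode is bounded by a constant depending on `m` alone —
`|Σ_{k ≠ k⋆} [log(4sinh²(tω(k)/2) + 4sin²(Φ/2)) − log(4sinh²(tω(k)/2) + 4sin²(Φ′/2))]| ≤ 4/(1 − e^{−4/3})² · (2/(1 − e^{−8/(3m)}))^m`.
[cite: Luscher1983, App.] [cite: LiebLoss1993, §4 (4.9)] -/
theorem abs_sum_log_flux_sub_le (hm : 0 < m) (hn : 0 < n) (hx : ∀ ν, 0 ≤ x₀ ν ∧ x₀ ν ≤ Real.pi / n) {t : ℝ} (ht : (n : ℝ) ≤ t) (Φ Φ' : ℝ) :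
    |∑ k ∈ (Finset.univ.erase fun ν => if x₀ ν ≤ Real.pi / (2 * n) then (⟨0, hn⟩ : Fin n) else ⟨n - 1, Nat.sub_lt hn one_pos⟩),
        (Real.log (4 * Real.sinh (t * (2 * Real.arsinh (Real.sqrt (∑ μ, 4 * Real.sin (x₀ μ + Real.pi * (k μ : ℕ) / n) ^ 2) / 2)) / 2) ^ 2 +
            4 * Real.sin (Φ / 2) ^ 2) -
          Real.log (4 * Real.sinh (t * (2 * Real.arsinh (Real.sqrt (∑ μ, 4 * Real.sin (x₀ μ + Real.pi * (k μ : ℕ) / n) ^ 2) / 2)) / 2) ^ 2 +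
            4 * Real.sin (Φ' / 2) ^ 2))| ≤
      4 / (1 - Real.exp (-(4 / 3 : ℝ))) ^ 2 * (2 / (1 - Real.exp (-(8 / (3 * m) : ℝ)))) ^ m := by
  have hnr : (0 : ℝ) < n := by exact_mod_cast hn
  have hmr : (0 : ℝ) < m := by exact_mod_cast hm
  have htpos : 0 < t := hnr.trans_le ht
  set kstar : Fin m → Fin n := fun ν => if x₀ ν ≤ Real.pi / (2 * n) then (⟨0, hn⟩ : Fin n) else ⟨n - 1, Nat.sub_lt hn one_pos⟩ with hkstar
  set ω : (Fin m → Fin n) → ℝ := fun k => 2 * Real.arsinh (Real.sqrt (∑ μ, 4 * Real.sin (x₀ μ + Real.pi * (k μ : ℕ) / n) ^ 2) / 2) with hω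
  have hc : 0 < 1 - Real.exp (-(4 / 3 : ℝ)) := by
    have : Real.exp (-(4 / 3 : ℝ)) < 1 := by rw [← Real.exp_zero]; exact Real.exp_lt_exp.2 (by norm_num)
    linarith
  -- termwise bound off the zero mode
  have hterm : ∀ k ∈ Finset.univ.erase kstar,
      |Real.log (4 * Real.sinh (t * ω k / 2) ^ 2 + 4 * Real.sin (Φ / 2) ^ 2) - Real.log (4 * Real.sinh (t * ω k / 2) ^ 2 + 4 * Real.sin (Φ' / 2) ^ 2)| ≤
        4 / (1 - Real.exp (-(4 / 3 : ℝ))) ^ 2 * Real.exp (-(t * ω k)) := by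
    intro k hk
    have hgap : 4 / 3 ≤ t * ω k := transFreq_ge_off_zeroMode x₀ hn hx k (Finset.ne_of_mem_erase hk) ht
    have hS : 0 < 4 * Real.sinh (t * ω k / 2) ^ 2 := by
      have : 0 < Real.sinh (t * ω k / 2) := Real.sinh_pos_iff.2 (by linarith)
      positivity
    have ha : (0 : ℝ) ≤ 4 * Real.sin (Φ / 2) ^ 2 := by positivity
    have haA : 4 * Real.sin (Φ / 2) ^ 2 ≤ 4 := by nlinarith [Real.sin_sq_le_one (Φ / 2)]
    have ha' : (0 : ℝ) ≤ 4 * Real.sin (Φ' / 2) ^ 2 := by positivity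
    have ha'A : 4 * Real.sin (Φ' / 2) ^ 2 ≤ 4 := by nlinarith [Real.sin_sq_le_one (Φ' / 2)]
    have h1 := abs_log_add_sub_log_add_le hS ha haA ha' ha'A
    have h2 := inv_four_sinh_sq_half_le (c := 4 / 3) (x := t * ω k) (by norm_num) hgap
    calc _ ≤ 4 / (4 * Real.sinh (t * ω k / 2) ^ 2) := h1
      _ = 4 * (4 * Real.sinh (t * ω k / 2) ^ 2)⁻¹ := by rw [div_eq_mul_inv]
      _ ≤ 4 * (Real.exp (-(t * ω k)) / (1 - Real.exp (-(4 / 3 : ℝ))) ^ 2) := by gcongr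
      _ = _ := by ring
  -- sum, enlarge to all modes, use the transverse exponential sum
  have hsum := Finset.abs_sum_le_sum_abs (fun k => Real.log (4 * Real.sinh (t * ω k / 2) ^ 2 + 4 * Real.sin (Φ / 2) ^ 2) -
      Real.log (4 * Real.sinh (t * ω k / 2) ^ 2 + 4 * Real.sin (Φ' / 2) ^ 2)) (Finset.univ.erase kstar)
  have h3 : ∑ k ∈ Finset.univ.erase kstar, |Real.log (4 * Real.sinh (t * ω k / 2) ^ 2 + 4 * Real.sin (Φ / 2) ^ 2) -
      Real.log (4 * Real.sinh (t * ω k / 2) ^ 2 + 4 * Real.sin (Φ' / 2) ^ 2)| ≤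
      ∑ k ∈ Finset.univ.erase kstar, 4 / (1 - Real.exp (-(4 / 3 : ℝ))) ^ 2 * Real.exp (-(t * ω k)) := Finset.sum_le_sum hterm
  have h4 : ∑ k ∈ Finset.univ.erase kstar, 4 / (1 - Real.exp (-(4 / 3 : ℝ))) ^ 2 * Real.exp (-(t * ω k)) ≤
      ∑ k : Fin m → Fin n, 4 / (1 - Real.exp (-(4 / 3 : ℝ))) ^ 2 * Real.exp (-(t * ω k)) :=
    Finset.sum_le_sum_of_subset_of_nonneg (Finset.erase_subset _ _) fun k _ _ => by positivity
  have h5 : ∑ k : Fin m → Fin n, 4 / (1 - Real.exp (-(4 / 3 : ℝ))) ^ 2 * Real.exp (-(t * ω k)) ≤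
      4 / (1 - Real.exp (-(4 / 3 : ℝ))) ^ 2 * (2 / (1 - Real.exp (-(8 * t / (3 * m * n))))) ^ m := by
    rw [← Finset.mul_sum]
    exact mul_le_mul_of_nonneg_left (sum_exp_neg_transFreq_le x₀ hm hn hx htpos) (by positivity)
  -- monotonicity in `t/n ≥ 1`
  have h6 : (2 / (1 - Real.exp (-(8 * t / (3 * m * n))))) ^ m ≤ (2 / (1 - Real.exp (-(8 / (3 * m) : ℝ)))) ^ m := by
    have he1 : Real.exp (-(8 * t / (3 * m * n))) ≤ Real.exp (-(8 / (3 * m) : ℝ)) := by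
      rw [Real.exp_le_exp, neg_le_neg_iff, div_le_div_iff₀ (by positivity) (by positivity)]
      nlinarith
    have h83 : (0 : ℝ) < 8 / (3 * m) := by positivity
    have he2 : Real.exp (-(8 / (3 * m) : ℝ)) < 1 := by rw [← Real.exp_zero]; exact Real.exp_lt_exp.2 (by linarith)
    have hp1 : 0 < 1 - Real.exp (-(8 / (3 * m) : ℝ)) := by linarith
    have hp2 : 1 - Real.exp (-(8 / (3 * m) : ℝ)) ≤ 1 - Real.exp (-(8 * t / (3 * m * n))) := by linarith
    have hle : 2 / (1 - Real.exp (-(8 * t / (3 * m * n)))) ≤ 2 / (1 - Real.exp (-(8 / (3 * m) : ℝ))) :=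
      div_le_div_of_nonneg_left (by norm_num) hp1 hp2
    have hp3 : 0 < 1 - Real.exp (-(8 * t / (3 * m * n))) := by linarith
    exact pow_le_pow_left₀ (by positivity) hle m
  calc _ ≤ _ := hsum
    _ ≤ _ := h3
    _ ≤ _ := h4
    _ ≤ _ := h5
    _ ≤ _ := mul_le_mul_of_nonneg_left h6 (by positivity)

end Uniform

/-! ## §5 The exact time sum (the one-direction determinant in logarithmic form) -/

/-- ★★ **The exact sum over the summed direction**: for a gapped transverse eigenvalue `λ > 0` with frequency `ω = 2arsinh(√λ/2)` and per-link phase `φ`,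
`Σ_{q<t} log(λ + 4 sin²(φ/2 + πq/t)) = log(4 sinh²(tω/2) + 4 sin²(tφ/2))` — lit ✓`prod_four_sinh_sq_add_four_sin_sq_add` read through `log`.
[cite: LiebLoss1993, §4 (4.9)] [cite: GarciaperezGonzalezarroyoOkawa2017, §2.3–§2.5] -/
theorem sum_log_time_eq {t : ℕ} (ht : 0 < t) {lam : ℝ} (hlam : 0 < lam) (φ : ℝ) :
    ∑ q ∈ range t, Real.log (lam + 4 * Real.sin (φ / 2 + Real.pi * q / t) ^ 2) =
      Real.log (4 * Real.sinh (t * (2 * Real.arsinh (Real.sqrt lam / 2)) / 2) ^ 2 + 4 * Real.sin (t * φ / 2) ^ 2) := by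
  have hω : 4 * Real.sinh (2 * Real.arsinh (Real.sqrt lam / 2) / 2) ^ 2 = lam := by
    rw [show 2 * Real.arsinh (Real.sqrt lam / 2) / 2 = Real.arsinh (Real.sqrt lam / 2) by ring, Real.sinh_arsinh, div_pow, Real.sq_sqrt hlam.le]
    ring
  have h := Literature.Analysis.Matrix.TwistedCycleLaplacian.prod_four_sinh_sq_add_four_sin_sq_add ht (2 * Real.arsinh (Real.sqrt lam / 2)) φ
  rw [hω] at h
  rw [← h, Real.log_prod]
  intro q _
  have : 0 ≤ 4 * Real.sin (φ / 2 + Real.pi * q / t) ^ 2 := by positivity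
  linarith

end Summit.QuantumFields.YangMills.Theorems.OneLoopUniform

end
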